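import Summits.QuantumAdvantage.QuantumAdvantage.Theorems.LinnikCubicClassGroupsDegreeOnePrimesEscapeLowerPITSmoothed
import Summits.QuantumAdvantage.QuantumAdvantage.Theorems.LinnikCubicClassGroupsDegreeOnePrimesEscapeLowerPITDensity
import Summits.QuantumAdvantage.QuantumAdvantage.Theorems.LinnikCubicClassGroupsDegreeOnePrimesEscapePerCharacterDeficitCounting
import Summits.QuantumAdvantage.QuantumAdvantage.Theorems.LinnikCubicClassGroupsDegreeOnePrimesEscapePerCharacterDeficitUnsmoothing
import Summits.QuantumAdvantage.QuantumAdvantage.Theorems.LinnikCubicClassGroupsDegreeOnePrimesEscapeLowerShadow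
import Literature.NumberTheory.LFunctions.GRHPrimeIdealCountLowerBound
import Literature.NumberTheory.LFunctions.UniformClassGroupPNTChebyshev
import Literature.NumberTheory.LFunctions.DedekindZeta1LogFreeTheorem14DegreeThree
import HarnessLib

/-!
# T5 · the one-sided lower prime ideal theorem unless a nearby zero, from the log-free
# zero-density estimate for `ζ₁_K` at ONE degree — and its discharge for degree `≤ 3`

Topic `Summits/QuantumAdvantage/QuantumAdvantage/Theorems`, stub `stub_lowerPIT_of_density` (T5) of the
line `subgroup-orthogonality-escape` for the crux `DegreeOnePrimesEscape` (stmt-QuantumAdvantage-11543) of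
route `LinnikCubicClassGroups`, in DEGREE-LOCAL form; cell B2b-1 (linnik-cubic), PART A.
HONEST FRAMING: the value of this file is a THEOREM (kernel-checked) — not summit progress.

**Statement (`lowerPIT_of_density_local`).** Let `n > 1`, `A` real, and assume the log-free zero-density
estimate for `ζ₁_K = (s−1)ζ_K` of number fields of degree `n` (the shape of the tree's
`logFreeDensity_dedekindZeta₁`, at the one degree `n`).  Then there is `C₁` such that for every `K` of
degree `n` with `κ_K ≥ Q^{−A}` (`Q = |d_K| n^n`) and every `x ≥ Q^{C₁}`:

  `29 · Li(x) ≤ 32 · π_K(x)`, OR `ζ_K(β₁) = 0` for some `β₁ ∈ (1 − 1/(8 log Q), 1)` with `(1 − β₁) log x < 4`.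

No Deuring–Heilbronn repulsion, no Siegel: the smoothed lower bound `re_coefFordK_one_tzTest_ge_or_exceptional`
(`Σ_n Λ_K(n) g(log n) ≥ (24/25) x` unless the nearby zero), the density hypothesis put in `Q`-form
(`lowerPIT_densityQ_local`, the degree-local copy of the tree's `lowerPIT_densityQ`), unsmoothing by
`abs_thetaChar_sub_re_coefFordK_le` at `χ = 1` with `unsmoothing_error_le` / `unsmoothing_small`
(`θ_K(x) ≥ (191/200) x`), `θ_K ≤ π_K log x` and `Li(x) ≤ (26/25) x/log x`
(`Dock.offsetLogIntegral_le_mul_div_log`).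

**Discharge (`lowerPITκ_of_le_three`, `lowerPITκ_three`).** For `n ≤ 3` the hypothesis is the tree's
`logFreeDensity_dedekindZeta₁_of_le_three` (Literature, `DedekindZeta1LogFreeTheorem14DegreeThree.lean`), so
T5 holds unconditionally for quadratic and cubic fields; `lowerPITκ_three` is, verbatim, the hypothesis
`hL` of `CubicEscape.cubicEscape_of_kappaInputs` (`…CubicEscape.lean`).
-/

noncomputable section

open Complex Real
open scoped NumberField nonZeroDivisors
open Literature.NumberTheory.LFunctions Literature.NumberTheory.LFunctions.NumberField
  Literature.NumberTheory.LFunctions.LogFreeLocal Literature.NumberTheory.LFunctions.TZWeight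

namespace Summit.QuantumAdvantage.QuantumAdvantage.Theorems.DegreeOnePrimesEscape

/-! ### The density hypothesis at one degree, in `Q`-form -/

open scoped Classical in
/-- **The density hypothesis for `ζ₁_K` in `Q`-form — DEGREE-LOCAL version** of the tree's
`lowerPIT_densityQ` (the estimate is assumed for the ONE degree `n`): with `a = max A 4` and the SAME
constants `c_D, C_D`, for every `K` of degree `n > 1` with `κ_K ≥ Q^{−A}`, `T ≥ 1`, every finite set `u` of
zeros of `ζ₁_K` with `1/4 ≤ β < 1`, `|γ| ≤ T`, and every `α ≤ 1`:
`Σ_{ρ ∈ u, β ≥ α} m(ρ) ≤ C_D e^{c_D(a log Q + log(T+4))(1−α)}`. -/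
theorem lowerPIT_densityQ_local (n : ℕ) (hn : 1 < n) (A : ℝ)
    (hDn : ∃ c_D C_D : ℝ, 0 < c_D ∧ 0 < C_D ∧
      ∀ (K : Type) [Field K] [NumberField K], Module.finrank ℚ K = n →
        ∀ P : ℝ, 2 ≤ P → ((NumberField.discr K).natAbs : ℝ) ≤ P →
          (Fintype.card (ClassGroup (𝓞 K)) : ℝ) ≤ P → P⁻¹ ≤ NumberField.dedekindZeta_residue K →
        ∀ Z : Finset ℂ, (∀ ρ ∈ Z, Literature.NumberTheory.LFunctions.dedekindZeta₁ K ρ = 0 ∧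
            1 / 4 ≤ ρ.re ∧ ρ.re < 1 ∧ |ρ.im| ≤ P) →
          ∀ α : ℝ, 0 ≤ α → α ≤ 1 →
            ∑ ρ ∈ Z with α ≤ ρ.re,
              (Literature.NumberTheory.LFunctions.LogFreeLocal.zeroOrder
                (Literature.NumberTheory.LFunctions.dedekindZeta₁ K) ρ : ℝ) ≤ C_D * P ^ (c_D * (1 - α))) :
    ∃ c_D C_D : ℝ, 0 < c_D ∧ 0 < C_D ∧
    ∀ (K : Type) [Field K] [NumberField K], Module.finrank ℚ K = n →
      ThornerZaman.condQn K ^ (-A) ≤ NumberField.dedekindZeta_residue K →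
      ∀ T : ℝ, 1 ≤ T → ∀ u : Finset ℂ,
        (∀ ρ ∈ u, dedekindZeta₁ K ρ = 0 ∧ 1 / 4 ≤ ρ.re ∧ ρ.re < 1 ∧ |ρ.im| ≤ T) →
        ∀ α : ℝ, α ≤ 1 →
          ∑ ρ ∈ u with α ≤ ρ.re, (analyticOrderNatAt (dedekindZeta₁ K) ρ : ℝ) ≤
            C_D * Real.exp (c_D * (max A 4 * Real.log (ThornerZaman.condQn K) + Real.log (T + 4))) ^ (1 - α) := by
  obtain ⟨c_D, C_D, hc, hC, hdens⟩ := hDn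
  refine ⟨c_D, C_D, hc, hC, fun K _ _ hKn hκ T hT u hu α hα1 ↦ ?_⟩
  have hK : 1 < Module.finrank ℚ K := by rw [hKn]; exact hn
  set a : ℝ := max A 4 with ha
  set Q : ℝ := ThornerZaman.condQn K with hQ
  have hQ12 : (12 : ℝ) ≤ Q := ThornerZaman.twelve_le_condQn (K := K) hK
  have hQ1 : (1 : ℝ) ≤ Q := by linarith
  set P : ℝ := Q ^ a * (T + 2) with hP
  obtain ⟨hP2, hdP, hhP, hκP, hTP⟩ :=
    sizeParam_admissible K hK (le_max_left _ _) (le_max_right _ _) hT hκ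
  -- clamp `α` at `0`
  set α' : ℝ := max α 0 with hα'
  have hα'0 : 0 ≤ α' := le_max_right _ _
  have hα'1 : α' ≤ 1 := max_le hα1 zero_le_one
  have hfilter : u.filter (fun ρ ↦ α ≤ ρ.re) = u.filter (fun ρ ↦ α' ≤ ρ.re) := by
    refine Finset.filter_congr fun ρ hρ ↦ ?_
    have := (hu ρ hρ).2.1
    rw [hα', max_le_iff]
    exact ⟨fun h ↦ ⟨h, by linarith⟩, fun h ↦ h.1⟩
  rw [hfilter]
  have huP : ∀ ρ ∈ u, dedekindZeta₁ K ρ = 0 ∧ 1 / 4 ≤ ρ.re ∧ ρ.re < 1 ∧ |ρ.im| ≤ P := by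
    intro ρ hρ
    obtain ⟨h0, h14, h1, hT'⟩ := hu ρ hρ
    exact ⟨h0, h14, h1, hT'.trans hTP⟩
  have key := hdens K hKn P hP2 hdP hhP hκP u huP α' hα'0 hα'1
  have key' : ∑ ρ ∈ u with α' ≤ ρ.re, (analyticOrderNatAt (dedekindZeta₁ K) ρ : ℝ) ≤
      C_D * P ^ (c_D * (1 - α')) := key
  refine key'.trans ?_
  -- `P^{c_D(1-α')} ≤ exp(c_D(a log Q + log(T+4)))^{1-α}`
  have hP1 : (1 : ℝ) ≤ P := by linarith
  have hQa0 : 0 < Q ^ a := Real.rpow_pos_of_pos (by linarith) _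
  have hPexp : P ≤ Real.exp (a * Real.log Q + Real.log (T + 4)) := by
    rw [Real.exp_add, Real.exp_log (by linarith), show a * Real.log Q = Real.log (Q ^ a) by
      rw [Real.log_rpow (by linarith)], Real.exp_log hQa0, hP]
    nlinarith
  set B : ℝ := Real.exp (c_D * (a * Real.log Q + Real.log (T + 4))) with hBdef
  have h1α : 0 ≤ 1 - α' := by linarith
  have hαα : 1 - α' ≤ 1 - α := by rw [hα']; exact sub_le_sub_left (le_max_left _ _) _
  have hB1 : 1 ≤ B := Real.one_le_exp (by
    have : 0 ≤ Real.log Q := Real.log_nonneg hQ1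
    have : 0 ≤ Real.log (T + 4) := Real.log_nonneg (by linarith)
    have : 0 ≤ a := le_trans (by norm_num) (le_max_right A 4)
    positivity)
  have hpow : P ^ (c_D * (1 - α')) ≤ B ^ (1 - α) := by
    calc P ^ (c_D * (1 - α')) = (P ^ c_D) ^ (1 - α') := by rw [Real.rpow_mul (by linarith)]
      _ ≤ (Real.exp (a * Real.log Q + Real.log (T + 4)) ^ c_D) ^ (1 - α') :=
          Real.rpow_le_rpow (by positivity) (Real.rpow_le_rpow (by linarith) hPexp hc.le) h1α
      _ = B ^ (1 - α') := by rw [hBdef, ← Real.exp_mul]; ring_nf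
      _ ≤ B ^ (1 - α) := Real.rpow_le_rpow_of_exponent_le hB1 hαα
  exact mul_le_mul_of_nonneg_left hpow hC.le

/-! ### T5, degree-local -/

/-- `Σ_C Re 1(C) · θ_C(x) = θ_K(x)` for the trivial class group character. -/
theorem sum_re_one_mul_chebyshevThetaIdealClass (K : Type) [Field K] [NumberField K] (x : ℝ) :
    ∑ C : ClassGroup (𝓞 K), (((1 : ClassGroup (𝓞 K) →* ℂˣ) C : ℂˣ) : ℂ).re * chebyshevThetaIdealClass K C x =
      chebyshevThetaIdeal K x := by
  simp only [MonoidHom.one_apply, Units.val_one, Complex.one_re, one_mul]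
  exact sum_chebyshevThetaIdealClass K x

set_option maxHeartbeats 800000 in
open scoped Classical in
/-- **T5 · `stub_lowerPIT_of_density` in DEGREE-LOCAL form** (see the module docstring): the log-free
zero-density estimate for `ζ₁_K` at the one degree `n > 1` implies, for every real `A`, the existence of `C₁`
with: for every `K` of degree `n` with `κ_K ≥ Q^{−A}` and every `x ≥ Q^{C₁}`, `29 Li(x) ≤ 32 π_K(x)` or
`ζ_K` has a real zero `β₁ ∈ (1 − 1/(8 log Q), 1)` with `(1 − β₁) log x < 4`. -/
theorem lowerPIT_of_density_local (n : ℕ) (hn : 1 < n) (A : ℝ)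
    (hDn : ∃ c_D C_D : ℝ, 0 < c_D ∧ 0 < C_D ∧
      ∀ (K : Type) [Field K] [NumberField K], Module.finrank ℚ K = n →
        ∀ P : ℝ, 2 ≤ P → ((NumberField.discr K).natAbs : ℝ) ≤ P →
          (Fintype.card (ClassGroup (𝓞 K)) : ℝ) ≤ P → P⁻¹ ≤ NumberField.dedekindZeta_residue K →
        ∀ Z : Finset ℂ, (∀ ρ ∈ Z, Literature.NumberTheory.LFunctions.dedekindZeta₁ K ρ = 0 ∧
            1 / 4 ≤ ρ.re ∧ ρ.re < 1 ∧ |ρ.im| ≤ P) →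
          ∀ α : ℝ, 0 ≤ α → α ≤ 1 →
            ∑ ρ ∈ Z with α ≤ ρ.re,
              (Literature.NumberTheory.LFunctions.LogFreeLocal.zeroOrder
                (Literature.NumberTheory.LFunctions.dedekindZeta₁ K) ρ : ℝ) ≤ C_D * P ^ (c_D * (1 - α))) :
    ∃ C₁ : ℝ, ∀ (K : Type) [Field K] [NumberField K], Module.finrank ℚ K = n →
      ThornerZaman.condQn K ^ (-A) ≤ NumberField.dedekindZeta_residue K →
      ∀ x : ℝ, ThornerZaman.condQn K ^ C₁ ≤ x →
        29 * offsetLogIntegral x ≤ 32 * (primeIdealCount K x : ℝ) ∨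
        ∃ β₁ : ℝ, 1 - 1 / (8 * Real.log (ThornerZaman.condQn K)) < β₁ ∧ β₁ < 1 ∧
          dedekindZetaCont K β₁ = 0 ∧ (1 - β₁) * Real.log x < 4 := by
  obtain ⟨b, D, hb, hD, hdensQ⟩ := lowerPIT_densityQ_local n hn A hDn
  have ha : (1 : ℝ) ≤ max A 4 := le_trans (by norm_num) (le_max_right _ _)
  obtain ⟨ν, a₁, hν0, hν64, ha₁1, hsm⟩ := re_coefFordK_one_tzTest_ge_or_exceptional n hn hb hD ha
  -- thresholds: `log x ≥ 60` for the `Li` bound and the unsmoothing absorption with `η = 1/200`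
  set Λu : ℝ := 2 / ν * Real.log (44 * ((n : ℝ) + 1) / (ν * (1 / 200))) with hΛu
  set C₁ : ℝ := max (max a₁ 30) Λu with hC₁
  have hC₁a₁ : a₁ ≤ C₁ := le_trans (le_max_left _ _) (le_max_left _ _)
  have hC₁30 : (30 : ℝ) ≤ C₁ := le_trans (le_max_right _ _) (le_max_left _ _)
  have hC₁Λ : Λu ≤ C₁ := le_max_right _ _
  refine ⟨C₁, fun K _ _ hKn hκ x hx ↦ ?_⟩
  have hK : 1 < Module.finrank ℚ K := by rw [hKn]; exact hn
  set Q : ℝ := ThornerZaman.condQn K with hQ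
  have hQ12 : (12 : ℝ) ≤ Q := ThornerZaman.twelve_le_condQn (K := K) hK
  have hQ1 : (1 : ℝ) < Q := by linarith
  have hlog12 : (2 : ℝ) ≤ Real.log 12 := by
    rw [Real.le_log_iff_exp_le (by norm_num)]
    have := Real.exp_one_lt_d9
    have h : Real.exp 2 = Real.exp 1 * Real.exp 1 := by rw [← Real.exp_add]; norm_num
    rw [h]; nlinarith [Real.exp_pos (1:ℝ)]
  have hlogQ : 2 ≤ Real.log Q := hlog12.trans (Real.log_le_log (by norm_num) hQ12)
  have hxa₁ : Q ^ a₁ ≤ x := le_trans (Real.rpow_le_rpow_of_exponent_le hQ1.le hC₁a₁) hx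
  have hxQ : Q ≤ x := by
    have : Q ^ (1 : ℝ) ≤ Q ^ a₁ := Real.rpow_le_rpow_of_exponent_le hQ1.le ha₁1
    rw [Real.rpow_one] at this; linarith
  have hx1 : 1 < x := by linarith
  have hx0 : 0 < x := by linarith
  set L : ℝ := Real.log x with hL
  have hLQ : C₁ * Real.log Q ≤ L := by
    have := Real.log_le_log (by positivity) hx
    rwa [Real.log_rpow (by linarith)] at this
  have hL60 : 60 ≤ L := by nlinarith
  have hL0 : 0 < L := by linarith
  have hexpL : Real.exp L = x := by rw [hL, Real.exp_log hx0]
  -- the smoothed dichotomy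
  rcases hsm K hKn (hdensQ K hKn hκ) x hxa₁ with hbig | hexc
  swap
  · exact Or.inr hexc
  left
  -- unsmoothing at `χ = 1`
  set ε : ℝ := x ^ (-ν) with hε
  have hε0 : 0 < ε := Real.rpow_pos_of_pos hx0 _
  have hε1 : ε ≤ 1 := Real.rpow_le_one_of_one_le_of_nonpos hx1.le (by linarith)
  have h1 := abs_thetaChar_sub_re_coefFordK_le (K := K) (1 : ClassGroup (𝓞 K) →* ℂˣ) hx1 hε0
  have h2 := unsmoothing_error_le (K := K) hx1 hε0 hε1
  rw [sum_re_one_mul_chebyshevThetaIdealClass K x] at h1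
  have h3 := (abs_le.1 (h1.trans h2)).1
  -- the unsmoothing error is `≤ x/200`
  have hsmall : (Module.finrank ℚ K : ℝ) * ((Real.log x + 1) * (8 * Real.sqrt x + 2 * ε * x + 1)) ≤
      (1 / 200) * x := by
    rw [hKn, hε]
    refine unsmoothing_small (Nat.cast_nonneg n) hν0 (by linarith) (by norm_num) ?_ ?_
    · rw [← hexpL]; exact Real.exp_le_exp.2 (by linarith)
    · rw [← hL, ← hΛu]; nlinarith
  have hθ : (191 / 200 : ℝ) * x ≤ chebyshevThetaIdeal K x := by
    rw [← hL] at h3 hsmall hbig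
    have : (Module.finrank ℚ K : ℝ) * ((L + 1) * (8 * Real.sqrt x + 2 * ε * x + 1)) ≤ (1 / 200) * x := hsmall
    linarith
  -- `θ_K ≤ π_K log x` and `Li ≤ (26/25) x/log x`
  have hπ := chebyshevThetaIdeal_le_primeIdealCount_mul_log (K := K) hx1.le
  have hLi : offsetLogIntegral x ≤ 26 / 25 * (x / Real.log x) :=
    Dock.offsetLogIntegral_le_mul_div_log (by rw [← hexpL]; exact Real.exp_le_exp.2 hL60)
  rw [← hL] at hπ hLi
  have hπ' : (191 / 200 : ℝ) * (x / L) ≤ (primeIdealCount K x : ℝ) := by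
    rw [mul_div_assoc', div_le_iff₀ hL0]
    linarith
  have hxL : 0 ≤ x / L := by positivity
  linarith

/-! ### The discharge for degree `≤ 3` -/

open scoped Classical in
/-- **T5 for number fields of degree `n ≤ 3`, UNCONDITIONAL** (the density hypothesis is the tree's
`logFreeDensity_dedekindZeta₁_of_le_three`): for `1 < n ≤ 3` and every real `A` there is `C₁` such that
for every `K` of degree `n` with `κ_K ≥ Q^{−A}` and every `x ≥ Q^{C₁}`, `29 Li(x) ≤ 32 π_K(x)` or `ζ_K`
has a real zero `β₁ ∈ (1 − 1/(8 log Q), 1)` with `(1 − β₁) log x < 4`. -/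
theorem lowerPITκ_of_le_three (n : ℕ) (hn : 1 < n) (hn3 : n ≤ 3) (A : ℝ) :
    ∃ C₁ : ℝ, ∀ (K : Type) [Field K] [NumberField K], Module.finrank ℚ K = n →
      ThornerZaman.condQn K ^ (-A) ≤ NumberField.dedekindZeta_residue K →
      ∀ x : ℝ, ThornerZaman.condQn K ^ C₁ ≤ x →
        29 * offsetLogIntegral x ≤ 32 * (primeIdealCount K x : ℝ) ∨
        ∃ β₁ : ℝ, 1 - 1 / (8 * Real.log (ThornerZaman.condQn K)) < β₁ ∧ β₁ < 1 ∧
          dedekindZetaCont K β₁ = 0 ∧ (1 - β₁) * Real.log x < 4 :=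
  lowerPIT_of_density_local n hn A (logFreeDensity_dedekindZeta₁_of_le_three n hn3)

/-- **T5 for CUBIC fields, UNCONDITIONAL** — verbatim the hypothesis `hL` of
`CubicEscape.cubicEscape_of_kappaInputs` (any real `A`): there is `C₁` such that for every cubic number
field `K` with `κ_K ≥ Q^{−A}` (`Q = 27|d_K|`) and every `x ≥ Q^{C₁}`, `29 Li(x) ≤ 32 π_K(x)` or `ζ_K` has a
real zero `β₁ ∈ (1 − 1/(8 log Q), 1)` with `(1 − β₁) log x < 4`. -/
theorem lowerPITκ_three (A : ℝ) :
    ∃ C₁ : ℝ, ∀ (K : Type) [Field K] [NumberField K], Module.finrank ℚ K = 3 →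
      ThornerZaman.condQn K ^ (-A) ≤ NumberField.dedekindZeta_residue K →
      ∀ x : ℝ, ThornerZaman.condQn K ^ C₁ ≤ x →
        29 * offsetLogIntegral x ≤ 32 * (primeIdealCount K x : ℝ) ∨
        ∃ β₁ : ℝ, 1 - 1 / (8 * Real.log (ThornerZaman.condQn K)) < β₁ ∧ β₁ < 1 ∧
          dedekindZetaCont K β₁ = 0 ∧ (1 - β₁) * Real.log x < 4 :=
  lowerPITκ_of_le_three 3 (by norm_num) le_rfl A

end Summit.QuantumAdvantage.QuantumAdvantage.Theorems.DegreeOnePrimesEscape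

end
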